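import Summits.QuantumFields.BalabanUV.Beta.FP.SliceExchangeDefect
import Summits.QuantumFields.BalabanUV.Beta.D1BFx.SliceTransferJets

/-!
# The slice exchange FROM 2-JETS ONLY (road «FP», route T rows (SX-STEP) ∕ (T-INST-j) for a jets-only literal)

Owner file of road «FP» (unit `b2b-balaban-beta-d1-p3`, gen 17), located question Q-FP-17-1 branch (β).  The integration theorem
`NestedStepLawOneShot.secondVar_oneShot_nestedStepLaw` (p307295) and the slice exchange `SliceExchangeDefect.secondVar_kkt_slice_change` are CURVE theorems:
their covariance ∕ gauge-invariance relations must hold EXACTLY along a `C²` background family.  The literal's torus objects of record are 2-JETS (zero-background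
tables + insertion families), which satisfy those relations only ORDER BY ORDER at `u = 0`.  This file proves the slice exchange from the finitely many jet relations
alone, re-using road BF-x's jet machinery `D1BFx.SliceTransferJets` (d1-p2 gen 4: the exactly invariant DRESSED polynomial curves `K̃ = ΠᵀKΠ`, `Q̃ = QΠ`,
`Π = 1 − W̃P`, `P·W̃ ≡ 1`) with the STATIC one-shot slice `P` as normaliser and a MOVING second slice `T` (the nested comb slice `[τ₂Q₁(u); τ₁]` of route T moves
with the averaging):
* §1 **`secondVar_kkt_slice_change_jets`** — TWO-SIDED Ward letters (`K W = 0`, `Kᵀ W = 0`, `Q W = 0` to second order at `0`), static `P`, moving `T`: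
  `secondVar (kkt K₀ [Q₀;P]) (kkt K₁ [Q₁;0]) (kkt K₂ [Q₂;0]) = secondVar (kkt K₀ [Q₀;T₀]) (kkt K₁ [Q₁;T₁]) (kkt K₂ [Q₂;T₂]) + 2·secondVar (PW₀) (PW₁) (PW₂)
   − 2·secondVar (T₀W₀) (T₁W₀ + T₀W₁) (T₂W₀ + 2T₁W₁ + T₀W₂)` — proof: `secondVar_kkt_slice_change` on BF-x's dressed curves, whose 2-jets are the given ones
  (`Kc_jets`, `Qc_jets`), then the Faddeev–Popov term is moved back from `W̃ = W(PW)⁻¹` to `W` (`secondVar_mul_right`, `secondVar_inv_jets`).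
* §2 **`secondVar_kkt_shear_jets`** — form shears by the constraint block are invisible to sliced bordered 2-jets: the 2-jet of `K + QᵀN + N'ᵀQ` bordered by
  `[Q; L]` has the same `secondVar` as that of `K` (NestedSliceExchange §1 pointwise along the quadratic Taylor curves).
* §3 **`secondVar_kkt_slice_change_jets_of_range`** — the same as §1 under the RELAXED Ward letters `K W = QᵀY`, `Kᵀ W = QᵀY'` to second order (gauge invariance
  on `ker Q` only, an3 (F2)): shear the form jets by `N = −(Y·(PW)⁻¹)·P` (jets), which restores the two-sided letters (§3a), apply §1, un-shear by §2.
HONEST: model-level finite-dimensional calculus; nothing here is the road's (SDF), (D1), BetaPertH, a continuum statement or Clay.  HONEST DEPENDENCY: continuum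
YM on T⁴ ⇐ BetaPertH ∧ nine spine estimates (0/9 proved); BetaPertH ⇐ (D1) ∧ (D4) ∧ CAP+tail; G-an2-4 gates asym, D1 and NE2/3/4.
-/

noncomputable section

namespace Summit.QuantumFields.BalabanUV.Beta.FP.SliceExchangeJets

open Matrix Filter Finset
open scoped Topology
open Literature.MathematicalPhysics.QuantumFieldTheory.Balaban1983to89.Beta.Composition (kkt)
open Summit.QuantumFields.BalabanUV.Beta.D1BFx.LogDetSecondVariation (secondVar secondVar_eq_of_logAbsDet_eq)
open Summit.QuantumFields.BalabanUV.Beta.D1BFx.SliceTransferModel (hasDerivAt_matMul hasDerivAt_transpose_mul hasDerivAt_matAdd hasDerivAt_kkt_fromRows)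
open Summit.QuantumFields.BalabanUV.Beta.D1BFx.SliceTransferJetsAlgebra (secondVar_one secondVar_mul_right secondVar_inv_jets sJ₀ sJ₁ sJ₂ wT₀ wT₁ wT₂
  tau_wT₀ tau_wT₁ tau_wT₂ pw_wT₀ pw_wT₁ pw_wT₂)
open Summit.QuantumFields.BalabanUV.Beta.D1BFx.SliceTransferJets (pc lc of_pc of_lc of_pc_zero of_lc_zero hasDerivAt_pc hasDerivAt_lc Kc Kc₁ Kc₂ Qc Qc₁ Qc₂
  hasDerivAt_Kc hasDerivAt_Kc₁ hasDerivAt_Qc hasDerivAt_Qc₁ Kc_mul_wT Kc_transpose_mul_wT Qc_mul_wT Kc_jets Qc_jets)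
open Summit.QuantumFields.BalabanUV.Beta.FP.SliceExchangeDefect (secondVar_kkt_slice_change)
open Summit.QuantumFields.BalabanUV.Beta.FP.NestedSliceExchange (det_kkt_add_transpose_mul det_kkt_add_mul_transpose det_kkt_fromRows_slice_change_of_range)

variable {ν μ ρ : Type*} [Fintype ν] [Fintype μ] [Fintype ρ] [DecidableEq ν] [DecidableEq μ] [DecidableEq ρ]

/-! ## §1 Two-sided Ward letters: static normalising slice `P`, moving second slice `T` -/

/-- [folklore] **THE SLICE EXCHANGE FROM 2-JETS, TWO-SIDED WARD LETTERS.**  Data: 2-jets `(K₀,K₁,K₂)` (form), `(Q₀,Q₁,Q₂)` (averaging), `(T₀,T₁,T₂)` (a MOVING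
slice), a STATIC slice `P`, `(W₀,W₁,W₂)` (gauge generators), with the Ward letters AT `u = 0` to second order — `K₀W₀ = 0`, `K₁W₀ + K₀W₁ = 0`,
`K₂W₀ + 2K₁W₁ + K₀W₂ = 0`, the same for `Kᵀ`, `Q₀W₀ = 0`, `Q₁W₀ + Q₀W₁ = 0`, `Q₂W₀ + 2Q₁W₁ + Q₀W₂ = 0` — and `det(PW₀) ≠ 0`, `det(T₀W₀) ≠ 0`,
`det kkt K₀ [Q₀;T₀] ≠ 0`.  CONCLUSION: `secondVar` of the `P`-sliced bordered 2-jet (slice rows `(P, 0, 0)`) `=` `secondVar` of the `T`-sliced bordered 2-jet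
`+ 2·secondVar (PW₀) (PW₁) (PW₂) − 2·secondVar (T₀W₀) (T₁W₀ + T₀W₁) (T₂W₀ + T₁W₁ + (T₁W₁ + T₀W₂))`. -/
theorem secondVar_kkt_slice_change_jets (K₀ K₁ K₂ : Matrix ν ν ℝ) (Q₀ Q₁ Q₂ : Matrix μ ν ℝ) (T₀ T₁ T₂ P : Matrix ρ ν ℝ) (W₀ W₁ W₂ : Matrix ν ρ ℝ)
    (a0 : K₀ * W₀ = 0) (a0t : K₀ᵀ * W₀ = 0) (a1 : K₁ * W₀ + K₀ * W₁ = 0) (a1t : K₁ᵀ * W₀ + K₀ᵀ * W₁ = 0)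
    (a2 : K₂ * W₀ + (2 : ℝ) • (K₁ * W₁) + K₀ * W₂ = 0) (a2t : K₂ᵀ * W₀ + (2 : ℝ) • (K₁ᵀ * W₁) + K₀ᵀ * W₂ = 0)
    (b0 : Q₀ * W₀ = 0) (b1 : Q₁ * W₀ + Q₀ * W₁ = 0) (b2 : Q₂ * W₀ + (2 : ℝ) • (Q₁ * W₁) + Q₀ * W₂ = 0)
    (hP : (P * W₀).det ≠ 0) (hT : (T₀ * W₀).det ≠ 0) (h0 : (kkt K₀ (fromRows Q₀ T₀)).det ≠ 0) :
    secondVar (kkt K₀ (fromRows Q₀ P)) (kkt K₁ (fromRows Q₁ (0 : Matrix ρ ν ℝ))) (kkt K₂ (fromRows Q₂ (0 : Matrix ρ ν ℝ)))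
      = secondVar (kkt K₀ (fromRows Q₀ T₀)) (kkt K₁ (fromRows Q₁ T₁)) (kkt K₂ (fromRows Q₂ T₂))
        + (2 * secondVar (P * W₀) (P * W₁) (P * W₂)
          - 2 * secondVar (T₀ * W₀) (T₁ * W₀ + T₀ * W₁) (T₂ * W₀ + T₁ * W₁ + (T₁ * W₁ + T₀ * W₂))) := by
  obtain ⟨hK0, hK1, hK2⟩ := Kc_jets (τ := P) a0 a0t a1 a1t a2 a2t
  obtain ⟨hQ0, hQ1, hQ2⟩ := Qc_jets (τ := P) b0 b1 b2
  have hS0 : (sJ₀ P W₀).det ≠ 0 := (Matrix.isUnit_nonsing_inv_det _ (isUnit_iff_ne_zero.2 hP)).ne_zero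
  -- non-degeneracy at `0`
  have hTW : (Matrix.of (pc T₀ T₁ T₂ 0) * Matrix.of (pc (wT₀ P W₀) (wT₁ P W₀ W₁) (wT₂ P W₀ W₁ W₂) 0)).det ≠ 0 := by
    rw [of_pc_zero, of_pc_zero]
    show (T₀ * (W₀ * sJ₀ P W₀)).det ≠ 0
    rw [← Matrix.mul_assoc, Matrix.det_mul]; exact mul_ne_zero hT hS0
  have hPW : (Matrix.of (pc P 0 0 0) * Matrix.of (pc (wT₀ P W₀) (wT₁ P W₀ W₁) (wT₂ P W₀ W₁ W₂) 0)).det ≠ 0 := by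
    rw [of_pc_zero, of_pc_zero, tau_wT₀ P W₀ hP, Matrix.det_one]; exact one_ne_zero
  have h0' : (kkt (Matrix.of (Kc K₀ K₁ K₂ P W₀ W₁ W₂ 0)) (fromRows (Matrix.of (Qc Q₀ Q₁ Q₂ P W₀ W₁ W₂ 0)) (Matrix.of (pc T₀ T₁ T₂ 0)))).det ≠ 0 := by
    rw [hK0, hQ0, of_pc_zero]; exact h0
  -- the curve theorem on the exactly invariant dressed polynomial curves (multiplier letters `Y = Y' = 0`)
  have h := secondVar_kkt_slice_change
    (K := Kc K₀ K₁ K₂ P W₀ W₁ W₂) (K₁ := Kc₁ K₀ K₁ K₂ P W₀ W₁ W₂) (K₂ := Kc₂ K₀ K₁ K₂ P W₀ W₁ W₂)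
    (Q := Qc Q₀ Q₁ Q₂ P W₀ W₁ W₂) (Q₁ := Qc₁ Q₀ Q₁ Q₂ P W₀ W₁ W₂) (Q₂ := Qc₂ Q₀ Q₁ Q₂ P W₀ W₁ W₂)
    (τ := pc T₀ T₁ T₂) (τ₁ := lc T₁ T₂) (τ₂ := T₂)
    (P := pc P 0 0) (P₁ := lc 0 0) (P₂ := (0 : Matrix ρ ν ℝ))
    (W := pc (wT₀ P W₀) (wT₁ P W₀ W₁) (wT₂ P W₀ W₁ W₂)) (W₁ := lc (wT₁ P W₀ W₁) (wT₂ P W₀ W₁ W₂)) (W₂ := wT₂ P W₀ W₁ W₂)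
    (Y := fun _ => Matrix.of.symm (0 : Matrix μ ρ ℝ)) (Y' := fun _ => Matrix.of.symm (0 : Matrix μ ρ ℝ))
    (Eventually.of_forall fun u => hasDerivAt_Kc K₀ K₁ K₂ P W₀ W₁ W₂ u) (hasDerivAt_Kc₁ K₀ K₁ K₂ P W₀ W₁ W₂)
    (Eventually.of_forall fun u => hasDerivAt_Qc Q₀ Q₁ Q₂ P W₀ W₁ W₂ u) (hasDerivAt_Qc₁ Q₀ Q₁ Q₂ P W₀ W₁ W₂)
    (Eventually.of_forall fun u => hasDerivAt_pc T₀ T₁ T₂ u) (hasDerivAt_lc T₁ T₂ 0)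
    (Eventually.of_forall fun u => hasDerivAt_pc P 0 0 u) (hasDerivAt_lc (0 : Matrix ρ ν ℝ) 0 0)
    (Eventually.of_forall fun u => hasDerivAt_pc (wT₀ P W₀) (wT₁ P W₀ W₁) (wT₂ P W₀ W₁ W₂) u)
    (hasDerivAt_lc (wT₁ P W₀ W₁) (wT₂ P W₀ W₁ W₂) 0)
    (Eventually.of_forall fun u => by
      rw [Kc_mul_wT K₀ K₁ K₂ P W₀ W₁ W₂ hP u]; simp only [Equiv.apply_symm_apply, Matrix.mul_zero])
    (Eventually.of_forall fun u => by
      rw [Kc_transpose_mul_wT K₀ K₁ K₂ P W₀ W₁ W₂ hP u]; simp only [Equiv.apply_symm_apply, Matrix.mul_zero])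
    (Eventually.of_forall fun u => Qc_mul_wT Q₀ Q₁ Q₂ P W₀ W₁ W₂ hP u)
    hTW hPW h0'
  rw [hK0, hK1, hK2, hQ0, hQ1, hQ2] at h
  simp only [of_pc_zero, of_lc_zero, Matrix.zero_mul, zero_add] at h
  rw [tau_wT₀ P W₀ hP, tau_wT₁ P W₀ W₁ hP, tau_wT₂ P W₀ W₁ W₂ hP, secondVar_one] at h
  -- the nested Faddeev–Popov term back in the original parametrisation `W = W̃·(PW)`
  have eT : secondVar (T₀ * wT₀ P W₀) (T₁ * wT₀ P W₀ + T₀ * wT₁ P W₀ W₁)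
        (T₂ * wT₀ P W₀ + T₁ * wT₁ P W₀ W₁ + (T₁ * wT₁ P W₀ W₁ + T₀ * wT₂ P W₀ W₁ W₂))
      = secondVar (T₀ * W₀) (T₁ * W₀ + T₀ * W₁) (T₂ * W₀ + T₁ * W₁ + (T₁ * W₁ + T₀ * W₂))
        - secondVar (P * W₀) (P * W₁) (P * W₂) := by
    have e3 : T₂ * wT₀ P W₀ + T₁ * wT₁ P W₀ W₁ + (T₁ * wT₁ P W₀ W₁ + T₀ * wT₂ P W₀ W₁ W₂)
        = T₂ * wT₀ P W₀ + (2 : ℝ) • (T₁ * wT₁ P W₀ W₁) + T₀ * wT₂ P W₀ W₁ W₂ := by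
      rw [two_smul]; abel
    rw [e3, ← pw_wT₀ T₀, ← pw_wT₁ T₀ T₁, ← pw_wT₂ T₀ T₁ T₂, secondVar_mul_right _ _ _ _ _ _ hT hS0]
    have eS : secondVar (sJ₀ P W₀) (sJ₁ P W₀ W₁) (sJ₂ P W₀ W₁ W₂) = -secondVar (P * W₀) (P * W₁) (P * W₂) :=
      secondVar_inv_jets _ _ _ hP
    have e3' : T₂ * W₀ + (2 : ℝ) • (T₁ * W₁) + T₀ * W₂ = T₂ * W₀ + T₁ * W₁ + (T₁ * W₁ + T₀ * W₂) := by
      rw [two_smul]; abel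
    rw [eS, e3']
    ring
  rw [eT] at h
  linarith

/-! ## §2 Form shears by the constraint block are invisible to sliced bordered 2-jets -/

/-- [folklore] **SHEARED FORM JETS HAVE THE SAME SLICED BORDERED SECOND VARIATION.**  For 2-jets `K`, `Q`, `N`, `N'`, `L` with `det kkt K₀ [Q₀;L₀] ≠ 0`, the bordered 2-jet of
the sheared form `K + QᵀN + N'ᵀQ` (product-rule jets displayed) by `[Q; L]` has the same `secondVar` as that of `K` — `NestedSliceExchange.det_kkt_add_transpose_mul` ∕
`det_kkt_add_mul_transpose` pointwise along the quadratic Taylor curves, then `LogDetSecondVariation.secondVar_eq_of_logAbsDet_eq`. -/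
theorem secondVar_kkt_shear_jets (K₀ K₁ K₂ : Matrix ν ν ℝ) (Q₀ Q₁ Q₂ N₀ N₁ N₂ N'₀ N'₁ N'₂ : Matrix μ ν ℝ) (L₀ L₁ L₂ : Matrix ρ ν ℝ)
    (h0 : (kkt K₀ (fromRows Q₀ L₀)).det ≠ 0) :
    secondVar (kkt (K₀ + Q₀ᵀ * N₀ + N'₀ᵀ * Q₀) (fromRows Q₀ L₀))
        (kkt (K₁ + (Q₁ᵀ * N₀ + Q₀ᵀ * N₁) + (N'₁ᵀ * Q₀ + N'₀ᵀ * Q₁)) (fromRows Q₁ L₁))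
        (kkt (K₂ + (Q₂ᵀ * N₀ + Q₁ᵀ * N₁ + (Q₁ᵀ * N₁ + Q₀ᵀ * N₂)) + (N'₂ᵀ * Q₀ + N'₁ᵀ * Q₁ + (N'₁ᵀ * Q₁ + N'₀ᵀ * Q₂))) (fromRows Q₂ L₂))
      = secondVar (kkt K₀ (fromRows Q₀ L₀)) (kkt K₁ (fromRows Q₁ L₁)) (kkt K₂ (fromRows Q₂ L₂)) := by
  -- the sheared form along the quadratic Taylor curves, its first-jet curve and second jet
  have hKs : ∀ u : ℝ, HasDerivAt
      (fun v => Matrix.of.symm (Matrix.of (pc K₀ K₁ K₂ v) + (Matrix.of (pc Q₀ Q₁ Q₂ v))ᵀ * Matrix.of (pc N₀ N₁ N₂ v)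
        + (Matrix.of (pc N'₀ N'₁ N'₂ v))ᵀ * Matrix.of (pc Q₀ Q₁ Q₂ v)))
      ((fun u => Matrix.of.symm (Matrix.of (lc K₁ K₂ u)
        + ((Matrix.of (lc Q₁ Q₂ u))ᵀ * Matrix.of (pc N₀ N₁ N₂ u) + (Matrix.of (pc Q₀ Q₁ Q₂ u))ᵀ * Matrix.of (lc N₁ N₂ u))
        + ((Matrix.of (lc N'₁ N'₂ u))ᵀ * Matrix.of (pc Q₀ Q₁ Q₂ u) + (Matrix.of (pc N'₀ N'₁ N'₂ u))ᵀ * Matrix.of (lc Q₁ Q₂ u)))) u) u := fun u =>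
    hasDerivAt_matAdd (hasDerivAt_matAdd (hasDerivAt_pc K₀ K₁ K₂ u) (hasDerivAt_transpose_mul (hasDerivAt_pc Q₀ Q₁ Q₂ u) (hasDerivAt_pc N₀ N₁ N₂ u)))
      (hasDerivAt_transpose_mul (hasDerivAt_pc N'₀ N'₁ N'₂ u) (hasDerivAt_pc Q₀ Q₁ Q₂ u))
  have hKs₁ : HasDerivAt
      (fun u => Matrix.of.symm (Matrix.of (lc K₁ K₂ u)
        + ((Matrix.of (lc Q₁ Q₂ u))ᵀ * Matrix.of (pc N₀ N₁ N₂ u) + (Matrix.of (pc Q₀ Q₁ Q₂ u))ᵀ * Matrix.of (lc N₁ N₂ u))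
        + ((Matrix.of (lc N'₁ N'₂ u))ᵀ * Matrix.of (pc Q₀ Q₁ Q₂ u) + (Matrix.of (pc N'₀ N'₁ N'₂ u))ᵀ * Matrix.of (lc Q₁ Q₂ u))))
      (Matrix.of.symm (K₂ + (Q₂ᵀ * Matrix.of (pc N₀ N₁ N₂ 0) + (Matrix.of (lc Q₁ Q₂ 0))ᵀ * Matrix.of (lc N₁ N₂ 0)
          + ((Matrix.of (lc Q₁ Q₂ 0))ᵀ * Matrix.of (lc N₁ N₂ 0) + (Matrix.of (pc Q₀ Q₁ Q₂ 0))ᵀ * N₂))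
        + (N'₂ᵀ * Matrix.of (pc Q₀ Q₁ Q₂ 0) + (Matrix.of (lc N'₁ N'₂ 0))ᵀ * Matrix.of (lc Q₁ Q₂ 0)
          + ((Matrix.of (lc N'₁ N'₂ 0))ᵀ * Matrix.of (lc Q₁ Q₂ 0) + (Matrix.of (pc N'₀ N'₁ N'₂ 0))ᵀ * Q₂)))) 0 :=
    hasDerivAt_matAdd (hasDerivAt_matAdd (hasDerivAt_lc K₁ K₂ 0)
      (hasDerivAt_matAdd (hasDerivAt_transpose_mul (hasDerivAt_lc Q₁ Q₂ 0) (hasDerivAt_pc N₀ N₁ N₂ 0))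
        (hasDerivAt_transpose_mul (hasDerivAt_pc Q₀ Q₁ Q₂ 0) (hasDerivAt_lc N₁ N₂ 0))))
      (hasDerivAt_matAdd (hasDerivAt_transpose_mul (hasDerivAt_lc N'₁ N'₂ 0) (hasDerivAt_pc Q₀ Q₁ Q₂ 0))
        (hasDerivAt_transpose_mul (hasDerivAt_pc N'₀ N'₁ N'₂ 0) (hasDerivAt_lc Q₁ Q₂ 0)))
  -- the two bordered curves
  have hA : ∀ᶠ u in 𝓝 (0 : ℝ), HasDerivAt
      (fun v => Matrix.of.symm (kkt (Matrix.of ((fun v => Matrix.of.symm (Matrix.of (pc K₀ K₁ K₂ v) + (Matrix.of (pc Q₀ Q₁ Q₂ v))ᵀ * Matrix.of (pc N₀ N₁ N₂ v)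
        + (Matrix.of (pc N'₀ N'₁ N'₂ v))ᵀ * Matrix.of (pc Q₀ Q₁ Q₂ v))) v)) (fromRows (Matrix.of (pc Q₀ Q₁ Q₂ v)) (Matrix.of (pc L₀ L₁ L₂ v)))))
      ((fun u => Matrix.of.symm (kkt (Matrix.of ((fun u => Matrix.of.symm (Matrix.of (lc K₁ K₂ u)
        + ((Matrix.of (lc Q₁ Q₂ u))ᵀ * Matrix.of (pc N₀ N₁ N₂ u) + (Matrix.of (pc Q₀ Q₁ Q₂ u))ᵀ * Matrix.of (lc N₁ N₂ u))
        + ((Matrix.of (lc N'₁ N'₂ u))ᵀ * Matrix.of (pc Q₀ Q₁ Q₂ u) + (Matrix.of (pc N'₀ N'₁ N'₂ u))ᵀ * Matrix.of (lc Q₁ Q₂ u)))) u))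
        (fromRows (Matrix.of (lc Q₁ Q₂ u)) (Matrix.of (lc L₁ L₂ u))))) u) u :=
    Eventually.of_forall fun u => hasDerivAt_kkt_fromRows (hKs u) (hasDerivAt_pc Q₀ Q₁ Q₂ u) (hasDerivAt_pc L₀ L₁ L₂ u)
  have hA₁ := hasDerivAt_kkt_fromRows hKs₁ (hasDerivAt_lc Q₁ Q₂ 0) (hasDerivAt_lc L₁ L₂ 0)
  have hB : ∀ᶠ u in 𝓝 (0 : ℝ), HasDerivAt (fun v => Matrix.of.symm (kkt (Matrix.of (pc K₀ K₁ K₂ v)) (fromRows (Matrix.of (pc Q₀ Q₁ Q₂ v)) (Matrix.of (pc L₀ L₁ L₂ v)))))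
      ((fun u => Matrix.of.symm (kkt (Matrix.of (lc K₁ K₂ u)) (fromRows (Matrix.of (lc Q₁ Q₂ u)) (Matrix.of (lc L₁ L₂ u))))) u) u :=
    Eventually.of_forall fun u => hasDerivAt_kkt_fromRows (hasDerivAt_pc K₀ K₁ K₂ u) (hasDerivAt_pc Q₀ Q₁ Q₂ u) (hasDerivAt_pc L₀ L₁ L₂ u)
  have hB₁ := hasDerivAt_kkt_fromRows (hasDerivAt_lc K₁ K₂ 0) (hasDerivAt_lc Q₁ Q₂ 0) (hasDerivAt_lc L₁ L₂ 0)
  -- pointwise: the sheared and the plain sliced bordered determinants agree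
  have hdet : ∀ u : ℝ, (kkt (Matrix.of (pc K₀ K₁ K₂ u) + (Matrix.of (pc Q₀ Q₁ Q₂ u))ᵀ * Matrix.of (pc N₀ N₁ N₂ u)
        + (Matrix.of (pc N'₀ N'₁ N'₂ u))ᵀ * Matrix.of (pc Q₀ Q₁ Q₂ u)) (fromRows (Matrix.of (pc Q₀ Q₁ Q₂ u)) (Matrix.of (pc L₀ L₁ L₂ u)))).det
      = (kkt (Matrix.of (pc K₀ K₁ K₂ u)) (fromRows (Matrix.of (pc Q₀ Q₁ Q₂ u)) (Matrix.of (pc L₀ L₁ L₂ u)))).det := fun u => by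
    rw [det_kkt_add_mul_transpose, det_kkt_add_transpose_mul]
  have hB0 : (Matrix.of ((fun v => Matrix.of.symm (kkt (Matrix.of (pc K₀ K₁ K₂ v)) (fromRows (Matrix.of (pc Q₀ Q₁ Q₂ v)) (Matrix.of (pc L₀ L₁ L₂ v))))) 0)).det ≠ 0 := by
    simp only [Equiv.apply_symm_apply, of_pc_zero]; exact h0
  have hA0 : (Matrix.of ((fun v => Matrix.of.symm (kkt (Matrix.of ((fun v => Matrix.of.symm (Matrix.of (pc K₀ K₁ K₂ v)
        + (Matrix.of (pc Q₀ Q₁ Q₂ v))ᵀ * Matrix.of (pc N₀ N₁ N₂ v) + (Matrix.of (pc N'₀ N'₁ N'₂ v))ᵀ * Matrix.of (pc Q₀ Q₁ Q₂ v))) v))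
        (fromRows (Matrix.of (pc Q₀ Q₁ Q₂ v)) (Matrix.of (pc L₀ L₁ L₂ v))))) 0)).det ≠ 0 := by
    simp only [Equiv.apply_symm_apply]; rw [hdet 0]; simpa only [of_pc_zero] using h0
  have heq : ∀ᶠ u in 𝓝 (0 : ℝ),
      Real.log |(Matrix.of ((fun v => Matrix.of.symm (kkt (Matrix.of ((fun v => Matrix.of.symm (Matrix.of (pc K₀ K₁ K₂ v)
        + (Matrix.of (pc Q₀ Q₁ Q₂ v))ᵀ * Matrix.of (pc N₀ N₁ N₂ v) + (Matrix.of (pc N'₀ N'₁ N'₂ v))ᵀ * Matrix.of (pc Q₀ Q₁ Q₂ v))) v))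
        (fromRows (Matrix.of (pc Q₀ Q₁ Q₂ v)) (Matrix.of (pc L₀ L₁ L₂ v))))) u)).det|
      = Real.log |(Matrix.of ((fun v => Matrix.of.symm (kkt (Matrix.of (pc K₀ K₁ K₂ v)) (fromRows (Matrix.of (pc Q₀ Q₁ Q₂ v)) (Matrix.of (pc L₀ L₁ L₂ v))))) u)).det| + 0 :=
    Eventually.of_forall fun u => by simp only [Equiv.apply_symm_apply, add_zero]; rw [hdet u]
  have h := secondVar_eq_of_logAbsDet_eq hA hA₁ hA0 hB hB₁ hB0 heq
  simp only [Equiv.apply_symm_apply, of_pc_zero, of_lc_zero] at h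
  exact h

/-! ## §3 Relaxed Ward letters (gauge invariance on `ker Q`): shear, exchange, un-shear -/

omit [Fintype μ] [DecidableEq ν] [DecidableEq μ] in
/-- [folklore] **THE LEFT-INVERSE JETS OF `P·W`**: `S = (P·W)⁻¹` along a curve has 2-jet `(S₀, S₁, S₂) = (sJ₀, sJ₁, sJ₂)` (road BF-x's letters) with
`S₀(PW₀) = 1`, `S₁(PW₀) + S₀(PW₁) = 0`, `S₂(PW₀) + 2S₁(PW₁) + S₀(PW₂) = 0`. -/
theorem sJ_mul_pw_jets (P : Matrix ρ ν ℝ) (W₀ W₁ W₂ : Matrix ν ρ ℝ) (hP : (P * W₀).det ≠ 0) :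
    sJ₀ P W₀ * (P * W₀) = 1 ∧ sJ₁ P W₀ W₁ * (P * W₀) + sJ₀ P W₀ * (P * W₁) = 0 ∧
      sJ₂ P W₀ W₁ W₂ * (P * W₀) + (2 : ℝ) • (sJ₁ P W₀ W₁ * (P * W₁)) + sJ₀ P W₀ * (P * W₂) = 0 := by
  have s0 : sJ₀ P W₀ * (P * W₀) = 1 := Matrix.nonsing_inv_mul _ (isUnit_iff_ne_zero.2 hP)
  refine ⟨s0, ?_, ?_⟩
  · simp only [sJ₁, Matrix.neg_mul, Matrix.mul_assoc, s0, Matrix.mul_one]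
    exact neg_add_cancel _
  · have e : sJ₂ P W₀ W₁ W₂ * (P * W₀) + (2 : ℝ) • (sJ₁ P W₀ W₁ * (P * W₁)) + sJ₀ P W₀ * (P * W₂)
        = -(sJ₀ P W₀ * (P * W₂) * (sJ₀ P W₀ * (P * W₀)))
          + (2 : ℝ) • (sJ₀ P W₀ * (P * W₁) * (sJ₀ P W₀ * (P * W₁)) * (sJ₀ P W₀ * (P * W₀)))
          - (2 : ℝ) • (sJ₀ P W₀ * (P * W₁) * (sJ₀ P W₀ * (P * W₁))) + sJ₀ P W₀ * (P * W₂) := by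
      simp only [sJ₂, sJ₁, Matrix.add_mul, Matrix.neg_mul, Matrix.smul_mul, smul_neg, Matrix.mul_assoc]
      abel
    rw [e, s0, Matrix.mul_one, Matrix.mul_one]
    abel

omit [Fintype μ] [DecidableEq ν] [DecidableEq μ] in
/-- [folklore] **THE SHEAR JETS `N = −Y·S·P` UNDO THE MULTIPLIER LETTERS**: `N₀W₀ = −Y₀`, `N₁W₀ + N₀W₁ = −Y₁`, `N₂W₀ + 2N₁W₁ + N₀W₂ = −Y₂` for
`N₀ = −Y₀S₀P`, `N₁ = −(Y₁S₀ + Y₀S₁)P`, `N₂ = −(Y₂S₀ + 2Y₁S₁ + Y₀S₂)P`. -/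
theorem shearJets_mul_gauge (P : Matrix ρ ν ℝ) (W₀ W₁ W₂ : Matrix ν ρ ℝ) (Y₀ Y₁ Y₂ : Matrix μ ρ ℝ) (hP : (P * W₀).det ≠ 0) :
    -(Y₀ * sJ₀ P W₀ * P) * W₀ = -Y₀ ∧
    -((Y₁ * sJ₀ P W₀ + Y₀ * sJ₁ P W₀ W₁) * P) * W₀ + -(Y₀ * sJ₀ P W₀ * P) * W₁ = -Y₁ ∧
    -((Y₂ * sJ₀ P W₀ + (2 : ℝ) • (Y₁ * sJ₁ P W₀ W₁) + Y₀ * sJ₂ P W₀ W₁ W₂) * P) * W₀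
      + (2 : ℝ) • (-((Y₁ * sJ₀ P W₀ + Y₀ * sJ₁ P W₀ W₁) * P) * W₁) + -(Y₀ * sJ₀ P W₀ * P) * W₂ = -Y₂ := by
  obtain ⟨s0, s1, s2⟩ := sJ_mul_pw_jets P W₀ W₁ W₂ hP
  refine ⟨?_, ?_, ?_⟩
  · simp only [Matrix.neg_mul, Matrix.mul_assoc, s0, Matrix.mul_one]
  · have e : -((Y₁ * sJ₀ P W₀ + Y₀ * sJ₁ P W₀ W₁) * P) * W₀ + -(Y₀ * sJ₀ P W₀ * P) * W₁
        = -(Y₁ * (sJ₀ P W₀ * (P * W₀))) - Y₀ * (sJ₁ P W₀ W₁ * (P * W₀) + sJ₀ P W₀ * (P * W₁)) := by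
      simp only [Matrix.add_mul, Matrix.neg_mul, Matrix.mul_add, Matrix.mul_assoc, neg_add]
      abel
    rw [e, s0, s1, Matrix.mul_one, Matrix.mul_zero, sub_zero]
  · have e : -((Y₂ * sJ₀ P W₀ + (2 : ℝ) • (Y₁ * sJ₁ P W₀ W₁) + Y₀ * sJ₂ P W₀ W₁ W₂) * P) * W₀
          + (2 : ℝ) • (-((Y₁ * sJ₀ P W₀ + Y₀ * sJ₁ P W₀ W₁) * P) * W₁) + -(Y₀ * sJ₀ P W₀ * P) * W₂
        = -(Y₂ * (sJ₀ P W₀ * (P * W₀))) - (2 : ℝ) • (Y₁ * (sJ₁ P W₀ W₁ * (P * W₀) + sJ₀ P W₀ * (P * W₁)))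
          - Y₀ * (sJ₂ P W₀ W₁ W₂ * (P * W₀) + (2 : ℝ) • (sJ₁ P W₀ W₁ * (P * W₁)) + sJ₀ P W₀ * (P * W₂)) := by
      simp only [Matrix.add_mul, Matrix.neg_mul, Matrix.mul_add, smul_add, smul_neg, Matrix.mul_assoc, neg_add, two_smul]
      abel
    rw [e, s0, s1, s2, Matrix.mul_one, Matrix.mul_zero, Matrix.mul_zero, smul_zero, sub_zero, sub_zero]

omit [Fintype ρ] [DecidableEq ν] [DecidableEq μ] [DecidableEq ρ] in
/-- [folklore] **SHEARING RESTORES THE TWO-SIDED WARD LETTERS**: if `K W = QᵀY` to second order (letters `a`), `N W = −Y` to second order (letters `z`) and `Q W = 0` to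
second order (letters `b`), then the sheared jets `K + QᵀN + MQ` (any `M`-jets) satisfy `(K + QᵀN + MQ)·W = 0` to second order. -/
theorem shear_ward {K₀ K₁ K₂ : Matrix ν ν ℝ} {Q₀ Q₁ Q₂ N₀ N₁ N₂ : Matrix μ ν ℝ} (M₀ M₁ M₂ : Matrix ν μ ℝ) {W₀ W₁ W₂ : Matrix ν ρ ℝ}
    {Y₀ Y₁ Y₂ : Matrix μ ρ ℝ}
    (a0 : K₀ * W₀ = Q₀ᵀ * Y₀) (a1 : K₁ * W₀ + K₀ * W₁ = Q₁ᵀ * Y₀ + Q₀ᵀ * Y₁)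
    (a2 : K₂ * W₀ + (2 : ℝ) • (K₁ * W₁) + K₀ * W₂ = Q₂ᵀ * Y₀ + (2 : ℝ) • (Q₁ᵀ * Y₁) + Q₀ᵀ * Y₂)
    (z0 : N₀ * W₀ = -Y₀) (z1 : N₁ * W₀ + N₀ * W₁ = -Y₁) (z2 : N₂ * W₀ + (2 : ℝ) • (N₁ * W₁) + N₀ * W₂ = -Y₂)
    (b0 : Q₀ * W₀ = 0) (b1 : Q₁ * W₀ + Q₀ * W₁ = 0) (b2 : Q₂ * W₀ + (2 : ℝ) • (Q₁ * W₁) + Q₀ * W₂ = 0) :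
    (K₀ + Q₀ᵀ * N₀ + M₀ * Q₀) * W₀ = 0 ∧
    (K₁ + (Q₁ᵀ * N₀ + Q₀ᵀ * N₁) + (M₁ * Q₀ + M₀ * Q₁)) * W₀ + (K₀ + Q₀ᵀ * N₀ + M₀ * Q₀) * W₁ = 0 ∧
    (K₂ + (Q₂ᵀ * N₀ + Q₁ᵀ * N₁ + (Q₁ᵀ * N₁ + Q₀ᵀ * N₂)) + (M₂ * Q₀ + M₁ * Q₁ + (M₁ * Q₁ + M₀ * Q₂))) * W₀
      + (2 : ℝ) • ((K₁ + (Q₁ᵀ * N₀ + Q₀ᵀ * N₁) + (M₁ * Q₀ + M₀ * Q₁)) * W₁) + (K₀ + Q₀ᵀ * N₀ + M₀ * Q₀) * W₂ = 0 := by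
  refine ⟨?_, ?_, ?_⟩
  · rw [Matrix.add_mul, Matrix.add_mul, Matrix.mul_assoc, Matrix.mul_assoc, a0, z0, b0, Matrix.mul_neg, Matrix.mul_zero, add_zero, add_neg_cancel]
  · have e : (K₁ + (Q₁ᵀ * N₀ + Q₀ᵀ * N₁) + (M₁ * Q₀ + M₀ * Q₁)) * W₀ + (K₀ + Q₀ᵀ * N₀ + M₀ * Q₀) * W₁
        = (K₁ * W₀ + K₀ * W₁) + Q₁ᵀ * (N₀ * W₀) + Q₀ᵀ * (N₁ * W₀ + N₀ * W₁) + M₁ * (Q₀ * W₀) + M₀ * (Q₁ * W₀ + Q₀ * W₁) := by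
      simp only [Matrix.add_mul, Matrix.mul_add, Matrix.mul_assoc]
      abel
    rw [e, a1, z0, z1, b0, b1, Matrix.mul_neg, Matrix.mul_neg, Matrix.mul_zero, Matrix.mul_zero]
    abel
  · have e : (K₂ + (Q₂ᵀ * N₀ + Q₁ᵀ * N₁ + (Q₁ᵀ * N₁ + Q₀ᵀ * N₂)) + (M₂ * Q₀ + M₁ * Q₁ + (M₁ * Q₁ + M₀ * Q₂))) * W₀
          + (2 : ℝ) • ((K₁ + (Q₁ᵀ * N₀ + Q₀ᵀ * N₁) + (M₁ * Q₀ + M₀ * Q₁)) * W₁) + (K₀ + Q₀ᵀ * N₀ + M₀ * Q₀) * W₂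
        = (K₂ * W₀ + (2 : ℝ) • (K₁ * W₁) + K₀ * W₂) + Q₂ᵀ * (N₀ * W₀) + (2 : ℝ) • (Q₁ᵀ * (N₁ * W₀ + N₀ * W₁))
          + Q₀ᵀ * (N₂ * W₀ + (2 : ℝ) • (N₁ * W₁) + N₀ * W₂)
          + M₂ * (Q₀ * W₀) + (2 : ℝ) • (M₁ * (Q₁ * W₀ + Q₀ * W₁)) + M₀ * (Q₂ * W₀ + (2 : ℝ) • (Q₁ * W₁) + Q₀ * W₂) := by
      simp only [Matrix.add_mul, Matrix.mul_add, smul_add, Matrix.mul_assoc, two_smul]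
      abel
    rw [e, a2, z0, z1, z2, b0, b1, b2, Matrix.mul_neg, Matrix.mul_neg, Matrix.mul_neg, Matrix.mul_zero, Matrix.mul_zero, Matrix.mul_zero]
    simp only [smul_neg, add_zero, smul_zero, two_smul]
    abel

/-- [folklore] **THE SLICE EXCHANGE FROM 2-JETS, RELAXED WARD LETTERS** (gauge invariance on `ker Q` only): as `secondVar_kkt_slice_change_jets`, with the form letters
`K₀W₀ = Q₀ᵀY₀`, `K₁W₀ + K₀W₁ = Q₁ᵀY₀ + Q₀ᵀY₁`, `K₂W₀ + 2K₁W₁ + K₀W₂ = Q₂ᵀY₀ + 2Q₁ᵀY₁ + Q₀ᵀY₂` and the same for `Kᵀ` with `Y'`.  PROOF: shear the form jets by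
`N = −Y·(PW)⁻¹·P` and `N' = −Y'·(PW)⁻¹·P` (jets) — `shear_ward` restores the two-sided letters — exchange by §1, un-shear both sides by §2. -/
theorem secondVar_kkt_slice_change_jets_of_range (K₀ K₁ K₂ : Matrix ν ν ℝ) (Q₀ Q₁ Q₂ : Matrix μ ν ℝ) (T₀ T₁ T₂ P : Matrix ρ ν ℝ) (W₀ W₁ W₂ : Matrix ν ρ ℝ)
    (Y₀ Y₁ Y₂ Y'₀ Y'₁ Y'₂ : Matrix μ ρ ℝ)
    (a0 : K₀ * W₀ = Q₀ᵀ * Y₀) (a1 : K₁ * W₀ + K₀ * W₁ = Q₁ᵀ * Y₀ + Q₀ᵀ * Y₁)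
    (a2 : K₂ * W₀ + (2 : ℝ) • (K₁ * W₁) + K₀ * W₂ = Q₂ᵀ * Y₀ + (2 : ℝ) • (Q₁ᵀ * Y₁) + Q₀ᵀ * Y₂)
    (a0t : K₀ᵀ * W₀ = Q₀ᵀ * Y'₀) (a1t : K₁ᵀ * W₀ + K₀ᵀ * W₁ = Q₁ᵀ * Y'₀ + Q₀ᵀ * Y'₁)
    (a2t : K₂ᵀ * W₀ + (2 : ℝ) • (K₁ᵀ * W₁) + K₀ᵀ * W₂ = Q₂ᵀ * Y'₀ + (2 : ℝ) • (Q₁ᵀ * Y'₁) + Q₀ᵀ * Y'₂)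
    (b0 : Q₀ * W₀ = 0) (b1 : Q₁ * W₀ + Q₀ * W₁ = 0) (b2 : Q₂ * W₀ + (2 : ℝ) • (Q₁ * W₁) + Q₀ * W₂ = 0)
    (hP : (P * W₀).det ≠ 0) (hT : (T₀ * W₀).det ≠ 0) (h0 : (kkt K₀ (fromRows Q₀ T₀)).det ≠ 0) :
    secondVar (kkt K₀ (fromRows Q₀ P)) (kkt K₁ (fromRows Q₁ (0 : Matrix ρ ν ℝ))) (kkt K₂ (fromRows Q₂ (0 : Matrix ρ ν ℝ)))
      = secondVar (kkt K₀ (fromRows Q₀ T₀)) (kkt K₁ (fromRows Q₁ T₁)) (kkt K₂ (fromRows Q₂ T₂))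
        + (2 * secondVar (P * W₀) (P * W₁) (P * W₂)
          - 2 * secondVar (T₀ * W₀) (T₁ * W₀ + T₀ * W₁) (T₂ * W₀ + T₁ * W₁ + (T₁ * W₁ + T₀ * W₂))) := by
  -- the shear jets
  set N₀ : Matrix μ ν ℝ := -(Y₀ * sJ₀ P W₀ * P) with hN₀
  set N₁ : Matrix μ ν ℝ := -((Y₁ * sJ₀ P W₀ + Y₀ * sJ₁ P W₀ W₁) * P) with hN₁
  set N₂ : Matrix μ ν ℝ := -((Y₂ * sJ₀ P W₀ + (2 : ℝ) • (Y₁ * sJ₁ P W₀ W₁) + Y₀ * sJ₂ P W₀ W₁ W₂) * P) with hN₂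
  set N'₀ : Matrix μ ν ℝ := -(Y'₀ * sJ₀ P W₀ * P) with hN'₀
  set N'₁ : Matrix μ ν ℝ := -((Y'₁ * sJ₀ P W₀ + Y'₀ * sJ₁ P W₀ W₁) * P) with hN'₁
  set N'₂ : Matrix μ ν ℝ := -((Y'₂ * sJ₀ P W₀ + (2 : ℝ) • (Y'₁ * sJ₁ P W₀ W₁) + Y'₀ * sJ₂ P W₀ W₁ W₂) * P) with hN'₂
  obtain ⟨z0, z1, z2⟩ := shearJets_mul_gauge P W₀ W₁ W₂ Y₀ Y₁ Y₂ hP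
  obtain ⟨z0', z1', z2'⟩ := shearJets_mul_gauge P W₀ W₁ W₂ Y'₀ Y'₁ Y'₂ hP
  rw [← hN₀] at z0
  rw [← hN₀, ← hN₁] at z1
  rw [← hN₀, ← hN₁, ← hN₂] at z2
  rw [← hN'₀] at z0'
  rw [← hN'₀, ← hN'₁] at z1'
  rw [← hN'₀, ← hN'₁, ← hN'₂] at z2'
  -- the sheared jets carry the two-sided letters
  obtain ⟨w0, w1, w2⟩ := shear_ward N'₀ᵀ N'₁ᵀ N'₂ᵀ a0 a1 a2 z0 z1 z2 b0 b1 b2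
  obtain ⟨w0t, w1t, w2t⟩ := shear_ward N₀ᵀ N₁ᵀ N₂ᵀ a0t a1t a2t z0' z1' z2' b0 b1 b2
  have t0 : (K₀ + Q₀ᵀ * N₀ + N'₀ᵀ * Q₀)ᵀ = K₀ᵀ + Q₀ᵀ * N'₀ + N₀ᵀ * Q₀ := by
    simp only [Matrix.transpose_add, Matrix.transpose_mul, Matrix.transpose_transpose]; abel
  have t1 : (K₁ + (Q₁ᵀ * N₀ + Q₀ᵀ * N₁) + (N'₁ᵀ * Q₀ + N'₀ᵀ * Q₁))ᵀ = K₁ᵀ + (Q₁ᵀ * N'₀ + Q₀ᵀ * N'₁) + (N₁ᵀ * Q₀ + N₀ᵀ * Q₁) := by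
    simp only [Matrix.transpose_add, Matrix.transpose_mul, Matrix.transpose_transpose]; abel
  have t2 : (K₂ + (Q₂ᵀ * N₀ + Q₁ᵀ * N₁ + (Q₁ᵀ * N₁ + Q₀ᵀ * N₂)) + (N'₂ᵀ * Q₀ + N'₁ᵀ * Q₁ + (N'₁ᵀ * Q₁ + N'₀ᵀ * Q₂)))ᵀ
      = K₂ᵀ + (Q₂ᵀ * N'₀ + Q₁ᵀ * N'₁ + (Q₁ᵀ * N'₁ + Q₀ᵀ * N'₂)) + (N₂ᵀ * Q₀ + N₁ᵀ * Q₁ + (N₁ᵀ * Q₁ + N₀ᵀ * Q₂)) := by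
    simp only [Matrix.transpose_add, Matrix.transpose_mul, Matrix.transpose_transpose]; abel
  rw [← t0] at w0t; rw [← t0, ← t1] at w1t; rw [← t0, ← t1, ← t2] at w2t
  -- the sheared `T`-sliced system is non-degenerate at `0`
  have h0s : (kkt (K₀ + Q₀ᵀ * N₀ + N'₀ᵀ * Q₀) (fromRows Q₀ T₀)).det ≠ 0 := by
    rw [det_kkt_add_mul_transpose, det_kkt_add_transpose_mul]; exact h0
  -- the plain `P`-sliced system is non-degenerate at `0` (p306639 §1 at `u = 0`)
  have h0P : (kkt K₀ (fromRows Q₀ P)).det ≠ 0 := by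
    have hid := det_kkt_fromRows_slice_change_of_range K₀ Q₀ T₀ P W₀ Y₀ Y'₀ a0 a0t b0 (isUnit_iff_ne_zero.2 hT) (isUnit_iff_ne_zero.2 hP)
    intro hz
    rw [hz, zero_mul] at hid
    exact (mul_ne_zero h0 (pow_ne_zero 2 hP)) hid.symm
  -- §1 on the sheared jets, §2 on both sides
  have h := secondVar_kkt_slice_change_jets _ _ _ Q₀ Q₁ Q₂ T₀ T₁ T₂ P W₀ W₁ W₂ w0 w0t w1 w1t w2 w2t b0 b1 b2 hP hT h0s
  rw [secondVar_kkt_shear_jets K₀ K₁ K₂ Q₀ Q₁ Q₂ N₀ N₁ N₂ N'₀ N'₁ N'₂ P 0 0 h0P,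
    secondVar_kkt_shear_jets K₀ K₁ K₂ Q₀ Q₁ Q₂ N₀ N₁ N₂ N'₀ N'₁ N'₂ T₀ T₁ T₂ h0] at h
  exact h

end Summit.QuantumFields.BalabanUV.Beta.FP.SliceExchangeJets

end
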